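import Summits.ValiantsHypothesis.ValiantsHypothesis.Theorems.PolyaContinuedMonotoneCoverHardGradedLowerBound
import Literature.Combinatorics.SimpleGraph.PfaffianBipartite

/-!
# Crux `MonotoneCoverHard` (stmt-ValiantsHypothesis-7421), width line — FINITE TEST, part 1: the
signed label matrix of a Pfaffian cover and its idle blocks

First file of the kernel proof that **no label-bijective Pfaffian cover of `per_n`, `n ≥ 3`, has a
single variable level** (the "cheapest falsifier" of line `width_cut` — one-level Pfaffian covers of
`per_3` / `per_4` — is thereby excluded at EVERY size `m`, not only small ones).  Lane of
val-width-7421-p3 g0 (2026-08-27, director's re-point: "the line's first finite test").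

Setting: a cover `(m, E, a)` of `per_n` (labels in `{X j, 0, 1}`, `per_n = aeval a PM_E`) whose edge
set is Pfaffian in the symbolic sense of the route; by `isPfaffianBipartite_iff_exists_mvPolynomial`
(Literature, Robertson–Seymour–Thomas (1.1)) this is a PÓLYA SIGNING `s : Fin m × Fin m → ℤˣ` of `E`.
The SIGNED LABEL MATRIX `M` has entry `C (s e) · a e` at every USED edge `e` (edge of some weight-nonzero
perfect matching) and `0` elsewhere; it is passed around through its defining equation `hM` (no
definitions are introduced).

* `exists_polyaSigning_of_symbolic` — the route's symbolic Pfaffian hypothesis yields a Pólya signing;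
* `det_signedLabel_eq_perPoly` — **`det M = per_n`**: by the Pólya property every weight-nonzero
  perfect matching contributes its label monomial with sign `+1`, and nothing else contributes;
* `det_idleBlock_eq_prod` — **idle blocks are unimodular**: for a weight-nonzero `τ₀` and a set `Z` of
  rows carrying no variable edge of `τ₀` such that no used edge `(i, τ₀ i')` with `i, i' ∈ Z` is a
  variable edge, the constant matrix `(s (i, τ₀ i'))·[used]` on `Z × Z` has determinant
  `∏_{i ∈ Z} s (i, τ₀ i)` (`= ±1`): a permutation `π ≠ 1` of `Z` contributing to the determinant would
  re-route the idle rows of `τ₀` into a second weight-nonzero perfect matching with the same variable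
  edges, contradicting label-injectivity (`eq_of_agree_on_var`).

Part 2 (`…OneLevel.lean`) eliminates the idle blocks by two Schur-complement steps with constant pivots
and lands `per_n = c · det L` with `L` an `n × n` matrix of affine-linear forms, against
Mignon–Ressayre.  VP ≠ VNP is not moved.  No definitions.
-/

namespace Summit.ValiantsHypothesis.ValiantsHypothesis.Theorems.PolyaContinuedMonotoneCoverHard

-- summit = sub-problem name (single-conjunct summit, D-0017 layout), so the namespace repeats it
set_option linter.dupNamespace false

open scoped Classical
open Finset
open Literature.Combinatorics.SimpleGraph (IsPolyaSigning isPfaffianBipartite_iff_exists_mvPolynomial)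

/-- The route's symbolic Pfaffian hypothesis (`det` of the `±`-signed symbolic biadjacency matrix equals
its permanent, over `ℂ`) yields a Pólya signing of the edge set. -/
theorem exists_polyaSigning_of_symbolic {m : ℕ} (E : Finset (Fin m × Fin m))
    (hsig : ∃ s : Fin m × Fin m → ℂ, (∀ e, s e = 1 ∨ s e = -1) ∧
      (Matrix.of fun i j => if (i, j) ∈ E then MvPolynomial.C (s (i, j)) * MvPolynomial.X (i, j)
          else 0 : Matrix (Fin m) (Fin m) (MvPolynomial (Fin m × Fin m) ℂ)).det =
        (Matrix.of fun i j => if (i, j) ∈ E then MvPolynomial.X (i, j) else 0 :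
          Matrix (Fin m) (Fin m) (MvPolynomial (Fin m × Fin m) ℂ)).permanent) :
    ∃ s : Fin m × Fin m → ℤˣ, IsPolyaSigning E s :=
  (isPfaffianBipartite_iff_exists_mvPolynomial E (by norm_num : (2 : ℂ) ≠ 0)).2 hsig

/-- **`det M = per_n` for the signed label matrix of a Pfaffian cover.**  `M` carries `C (s e) · a e`
on the used edges `e` (`hM`); every weight-nonzero perfect matching `σ` uses only used edges and
contributes `sign σ · ∏ s · ∏ a = ∏ a` by the Pólya property, every other permutation contributes `0`
on both sides. -/
theorem det_signedLabel_eq_perPoly {m n : ℕ} (E : Finset (Fin m × Fin m))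
    (a : Fin m × Fin m → MvPolynomial (Fin n × Fin n) ℂ)
    (hper : Literature.Computability.AlgebraicComplexity.perPoly (Fin n) ℂ =
      MvPolynomial.aeval a (Matrix.of fun i j => if (i, j) ∈ E then MvPolynomial.X (i, j) else 0 :
          Matrix (Fin m) (Fin m) (MvPolynomial (Fin m × Fin m) ℂ)).permanent)
    (s : Fin m × Fin m → ℤˣ) (hs : IsPolyaSigning E s)
    (M : Matrix (Fin m) (Fin m) (MvPolynomial (Fin n × Fin n) ℂ))
    (hM : ∀ i j, M i j =
      if ∃ τ : Equiv.Perm (Fin m), (∀ k, (k, τ k) ∈ E ∧ a (k, τ k) ≠ 0) ∧ τ i = j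
      then MvPolynomial.C ((s (i, j) : ℤ) : ℂ) * a (i, j) else 0) :
    M.det = Literature.Computability.AlgebraicComplexity.perPoly (Fin n) ℂ := by
  -- both sides equal the sum of `∏ a (i, σ i)` over the weight-nonzero perfect matchings `σ`
  have hR : Literature.Computability.AlgebraicComplexity.perPoly (Fin n) ℂ =
      ∑ σ : Equiv.Perm (Fin m), if (∀ i, (i, σ i) ∈ E ∧ a (i, σ i) ≠ 0) then ∏ i, a (i, σ i)
        else 0 := by
    rw [hper, ← Matrix.permanent_transpose]
    simp only [Matrix.permanent, Matrix.transpose_apply, Matrix.of_apply, map_sum, map_prod]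
    refine Finset.sum_congr rfl fun σ _ => ?_
    have hfac : ∀ e : Fin m × Fin m,
        MvPolynomial.aeval a (if e ∈ E then MvPolynomial.X e else 0 : MvPolynomial _ ℂ) =
          if e ∈ E then a e else 0 := by
      intro e; split_ifs <;> simp
    simp_rw [hfac]
    split_ifs with hσ
    · exact Finset.prod_congr rfl fun i _ => by rw [if_pos (hσ i).1]
    · obtain ⟨i, hi⟩ := not_forall.1 hσ
      apply Finset.prod_eq_zero (Finset.mem_univ i)
      by_cases h1 : (i, σ i) ∈ E
      · rw [if_pos h1]; by_contra h2; exact hi ⟨h1, h2⟩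
      · rw [if_neg h1]
  have hL : M.det =
      ∑ σ : Equiv.Perm (Fin m), if (∀ i, (i, σ i) ∈ E ∧ a (i, σ i) ≠ 0) then ∏ i, a (i, σ i)
        else 0 := by
    rw [← Matrix.det_transpose, Matrix.det_apply']
    refine Finset.sum_congr rfl fun σ _ => ?_
    simp only [Matrix.transpose_apply]
    split_ifs with hσ
    · -- all edges of `σ` are used (witness `σ` itself)
      have hM' : ∀ i, M i (σ i) = MvPolynomial.C ((s (i, σ i) : ℤ) : ℂ) * a (i, σ i) := by
        intro i
        rw [hM, if_pos ⟨σ, hσ, rfl⟩]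
      simp_rw [hM']
      rw [Finset.prod_mul_distrib, ← map_prod, ← mul_assoc]
      have hpol := hs σ fun i => (hσ i).1
      have hone : ((Equiv.Perm.sign σ : ℤ) : ℂ) * ∏ i, ((s (i, σ i) : ℤ) : ℂ) = 1 := by
        have := congrArg (fun u : ℤˣ => ((u : ℤ) : ℂ)) hpol
        simpa [Units.val_mul, Units.coe_prod] using this
      rw [← map_intCast (MvPolynomial.C : ℂ →+* MvPolynomial (Fin n × Fin n) ℂ), ← map_mul, hone,
        map_one, one_mul]
    · -- some edge of `σ` is unused, so its entry vanishes
      have : ∃ i, ¬ ∃ τ : Equiv.Perm (Fin m), (∀ k, (k, τ k) ∈ E ∧ a (k, τ k) ≠ 0) ∧ τ i = σ i := by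
        by_contra hall
        apply hσ
        intro i
        obtain ⟨τ, hτ, hτi⟩ := not_not.1 (not_exists.1 hall i)
        rw [← hτi]; exact hτ i
      obtain ⟨i, hi⟩ := this
      rw [Finset.prod_eq_zero (Finset.mem_univ i) (by rw [hM, if_neg hi]), mul_zero]
  rw [hL, hR]

/-- **Idle blocks are unimodular.**  Let `τ₀` be a weight-nonzero perfect matching of a cover of
`per_n` and `Z` a set of rows none of which carries a variable edge of `τ₀`, such that no USED edge
from a row of `Z` to a `τ₀`-column of `Z` is a variable edge.  Then the constant matrix
`S (i, i') = s (i, τ₀ i') · [(i, τ₀ i') used]` on `Z × Z` has `det S = ∏_{i ∈ Z} s (i, τ₀ i)`: any other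
permutation of `Z` contributing to the determinant would re-route the idle rows of `τ₀` into a second
weight-nonzero perfect matching with the same variable edges (`eq_of_agree_on_var`). -/
theorem det_idleBlock_eq_prod {m n : ℕ} (E : Finset (Fin m × Fin m))
    (a : Fin m × Fin m → MvPolynomial (Fin n × Fin n) ℂ)
    (ha : ∀ e, (∃ j, a e = MvPolynomial.X j) ∨ a e = 0 ∨ a e = 1)
    (hper : Literature.Computability.AlgebraicComplexity.perPoly (Fin n) ℂ =
      MvPolynomial.aeval a (Matrix.of fun i j => if (i, j) ∈ E then MvPolynomial.X (i, j) else 0 :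
          Matrix (Fin m) (Fin m) (MvPolynomial (Fin m × Fin m) ℂ)).permanent)
    (s : Fin m × Fin m → ℤˣ) (τ₀ : Equiv.Perm (Fin m)) (hτ₀ : ∀ i, (i, τ₀ i) ∈ E ∧ a (i, τ₀ i) ≠ 0)
    (Z : Fin m → Prop) (hZ : ∀ i, Z i → ¬ ∃ k, a (i, τ₀ i) = MvPolynomial.X k)
    (hZZ : ∀ i i', Z i → Z i' →
      (∃ τ : Equiv.Perm (Fin m), (∀ k, (k, τ k) ∈ E ∧ a (k, τ k) ≠ 0) ∧ τ i = τ₀ i') →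
      ¬ ∃ k, a (i, τ₀ i') = MvPolynomial.X k)
    (S : Matrix {i // Z i} {i // Z i} ℂ)
    (hS : ∀ i i' : {i // Z i}, S i i' =
      if ∃ τ : Equiv.Perm (Fin m), (∀ k, (k, τ k) ∈ E ∧ a (k, τ k) ≠ 0) ∧ τ i = τ₀ i'
      then ((s (i, τ₀ i') : ℤ) : ℂ) else 0) :
    S.det = ∏ i : {i // Z i}, ((s (i, τ₀ i) : ℤ) : ℂ) := by
  rw [Matrix.det_apply', Finset.sum_eq_single (1 : Equiv.Perm {i // Z i})]
  · simp only [Equiv.Perm.sign_one, Units.val_one, Int.cast_one, one_mul, Equiv.Perm.one_apply]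
    refine Finset.prod_congr rfl fun i _ => ?_
    rw [hS, if_pos ⟨τ₀, hτ₀, rfl⟩]
  · -- a permutation `π ≠ 1` of `Z` contributes nothing
    intro π _ hπ
    by_contra hne
    have hprod : ∀ i : {i // Z i}, S (π i) i ≠ 0 := by
      intro i h0
      exact hne (by rw [Finset.prod_eq_zero (f := fun j => S (π j) j) (Finset.mem_univ i) h0, mul_zero])
    have hused : ∀ i : {i // Z i}, ∃ τ : Equiv.Perm (Fin m),
        (∀ k, (k, τ k) ∈ E ∧ a (k, τ k) ≠ 0) ∧ τ (π i) = τ₀ i := by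
      intro i
      by_contra h
      exact hprod i (by rw [hS, if_neg h])
    -- re-routed matching: row `π i` gets column `τ₀ i` on `Z`, `τ₀` elsewhere
    set τ' : Equiv.Perm (Fin m) := τ₀ * Equiv.Perm.ofSubtype π⁻¹ with hτ'
    have hτ'Z : ∀ x : {i // Z i}, τ' x = τ₀ ((π⁻¹ x : {i // Z i}) : Fin m) := by
      intro x
      rw [hτ', Equiv.Perm.mul_apply, Equiv.Perm.ofSubtype_apply_coe]
    have hτ'nZ : ∀ j, ¬ Z j → τ' j = τ₀ j := by
      intro j hj
      rw [hτ', Equiv.Perm.mul_apply, Equiv.Perm.ofSubtype_apply_of_not_mem _ hj]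
    have hgood' : ∀ j, (j, τ' j) ∈ E ∧ a (j, τ' j) ≠ 0 := by
      intro j
      by_cases hj : Z j
      · obtain ⟨τ, hτ, hτj⟩ := hused (π⁻¹ ⟨j, hj⟩)
        have e2 : π (π⁻¹ ⟨j, hj⟩) = ⟨j, hj⟩ := by simp
        rw [e2] at hτj
        have e1 : τ' j = τ₀ ((π⁻¹ ⟨j, hj⟩ : {i // Z i}) : Fin m) := hτ'Z ⟨j, hj⟩
        rw [e1, ← hτj]
        exact hτ j
      · rw [hτ'nZ j hj]; exact hτ₀ j
    have heq : τ₀ = τ' := by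
      refine eq_of_agree_on_var E a ha hper τ₀ τ' hτ₀ hgood' fun j hj => ?_
      by_cases hjZ : Z j
      · exfalso
        rcases hj with hj | hj
        · exact hZ j hjZ hj
        · have e1 : τ' j = τ₀ ((π⁻¹ ⟨j, hjZ⟩ : {i // Z i}) : Fin m) := hτ'Z ⟨j, hjZ⟩
          rw [e1] at hj
          obtain ⟨τ, hτ, hτj⟩ := hused (π⁻¹ ⟨j, hjZ⟩)
          have e2 : π (π⁻¹ ⟨j, hjZ⟩) = ⟨j, hjZ⟩ := by simp
          rw [e2] at hτj
          exact hZZ j _ hjZ (π⁻¹ ⟨j, hjZ⟩).2 ⟨τ, hτ, hτj⟩ hj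
      · exact (hτ'nZ j hjZ).symm
    apply hπ
    refine Equiv.ext fun x => ?_
    have h1 : τ₀ (x : Fin m) = τ₀ ((π⁻¹ x : {i // Z i}) : Fin m) := by
      conv_lhs => rw [heq]
      exact hτ'Z x
    have h2 : (x : Fin m) = ((π⁻¹ x : {i // Z i}) : Fin m) := τ₀.injective h1
    have h3 : π⁻¹ x = x := (Subtype.ext h2).symm
    have h4 : π x = x := by
      have := congrArg π h3
      have e2 : π (π⁻¹ x) = x := by simp
      rw [e2] at this
      exact this.symm
    rw [Equiv.Perm.one_apply]
    exact h4
  · intro h; exact absurd (Finset.mem_univ _) h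

end Summit.ValiantsHypothesis.ValiantsHypothesis.Theorems.PolyaContinuedMonotoneCoverHard
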